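import Literature.MeasureTheory.Group.InvariantQuotientConjugacySum   -- ★ `descConj` : the orbital integrand `y M ↦ a (y γ y⁻¹)` on `G ⧸ M`
import Literature.MeasureTheory.Group.InvariantQuotientPi             -- ★ `quotientPiHomeomorph` : `(Π G_i) ⧸ (Π M_i) ≃ₜ Π (G_i ⧸ M_i)`, `quotientPiEquiv_mk`
import Literature.MeasureTheory.Group.InvariantQuotientTransport      -- ★ `cosetCongr`, `cosetCongrHomeomorph` : `G ⧸ M ≃ₜ G′ ⧸ M′` along `e : G ≃* G′`
import Mathlib.MeasureTheory.Integral.Bochner.Set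
import HarnessLib

/-!
# Uniform properness modulo a closed subgroup ⇒ continuity of quotient orbital integrals; finite products («places multiply»)
(Harish-Chandra; Deitmar–Echterhoff (2014) Lemma 9.3.3; Rogawski (1990) §8.3 p. 122; Shelstad (1979) §4; Folland (1995) §2.6 Thm. 2.49;
Gelbart (1975) p. 155 (10.19))

Topic `MeasureTheory/Group`; namespace `Literature.MeasureTheory.Group`.  THEOREMS ONLY (no `def`, no instance, no notation, no axiom, no
named fact, no `sorry`); generic (any topological groups), Mathlib + three ★ plumbing modules.  Cell `pub/hodgecm-mathlib`, crux H413
(`stmt-HodgeConjecture-24833`), line LH3 (closer stub `stub_N9`, DIRECT ROAD, clause (M1) «ordinary orbital integrals of `a′ ∈ C_c(G′_∞)` are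
continuous on the regular set of EVERY Cartan `T_{S′}`»); organ «(W1-cont-Π)» = the PRODUCT∕PLACES ASSEMBLY of ★ `ArchHyperbolicOrbitProperThree`
(L2∕L3, one split place), dealt by LH3-plan (g2) 2026-09-02T05:31:39Z to LH2-p04 (g3).  Count-neutral (VOL)∕(CONV) kit.

THE MATHEMATICS.  Fix a topological group `G`, a subgroup `M ≤ G`, a continuous chart `c : X → G` of elements commuting with `M`
(`m · c x = c x · m`; think `M = T` a Cartan subgroup and `c` a coordinate chart of `T`), and the quotient orbital integrals
`O(x) := ∫_{G ⧸ M} a(y · c(x) · y⁻¹) dμ(ȳ)` (★ `descConj`) of a test function `a ∈ C_c(G, E)` against ANY measure `μ` on `G ⧸ M` finite on compact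
sets (e.g. a Weil quotient `dν ∕ dt`).  Say the data is **uniformly proper modulo `M` on `S ⊆ X`** when

  `∀ K ⊆ S` compact, `∀ C ⊆ G` compact, `∃ 𝒦 ⊆ G ⧸ M` compact with `ȳ ∈ 𝒦` whenever `y · c(x) · y⁻¹ ∈ C` for some `x ∈ K`   (HYP)

(spelled out inline in every statement — no definition is introduced).  Then:
* §1 **`continuousOn_integral_descConj_of_uniformlyProper`** — (HYP) on an open `S` (with `X` locally compact) ⇒ `O` is `ContinuousOn S`: near a point of
  `S` the integrands `ȳ ↦ a(y c(x) y⁻¹)` are supported in ONE compact `𝒦` and depend continuously on `(x, ȳ)` (open quotient map `id × mk`), so Mathlib's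
  `continuousOn_integral_of_compact_support` applies.  This is EXACTLY the proof of ★ L3 `continuousOn_integral_descConj_of_diag_hyperbolic`
  (`G = U(Φ₃)(ℂ)`, `M` = the split Cartan, (HYP) = ★ L2) made generic, and of ★ `continuousOn_integral_descConj_archDiagTorus_of_hasCompactSupport`
  (compact Cartan).
* §2 (HYP) is stable under the operations the places assembly needs: **`uniformlyProper_pi`** — finite products `(Π G_i, Π M_i, (c_i), Π S_i)`
  («places multiply»: `𝒦 := quotientPiHomeomorph⁻¹ (Π 𝒦_i)`, ★ `InvariantQuotientPi`); **`uniformlyProper_of_forall_exists_isCompact`** — the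
  GROUP-level properness «`{y ∣ ∃ x ∈ K, y c(x) y⁻¹ ∈ C}` is relatively compact in `G_i`» (compact Cartan factors, ★ `isCompact_setOf_exists_conj_circleDiagonal_mem`)
  implies (HYP); **`uniformlyProper_of_compactSpace`** — a compact factor (a definite place) satisfies (HYP) for free;
  **`uniformlyProper_map_mulEquiv`** — transport along a bicontinuous `e : G ≃* G′` with `e(M) = M′` (★ `cosetCongrHomeomorph`).
* §3 **`continuousOn_integral_descConj_pi_of_uniformlyProper`** and **`continuousOn_integral_descConj_mulEquiv_pi_of_uniformlyProper`** = §1 ∘ §2: for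
  factors each uniformly proper on `S_i`, the orbital integrals over `(Π G_i) ⧸ (Π M_i)` — and over `G′ ⧸ M′` for any `G′ ≅ Π G_i` carrying `Π M_i` to `M′`,
  e.g. `G′_∞ = U(H′)(L⁺ ⊗ ℝ) ≅ Π_w G′_w` (★ `archPiEquivCM`) with `M′ = T_{S′} ≅ Π_w T_w` — are `ContinuousOn (Set.pi univ S_i)`, the product of the
  regular sets, for every `a ∈ C_c` and every measure finite on compacts.
NOT HERE (next file, the `U(2,1)^d` dress): the per-place inputs — split places ★ `exists_isCompact_forall_hsOrbit_subset_of_diag_hyperbolic` (L2, after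
«compact ⊆ HS-ball»), compact places ★ `isCompact_setOf_exists_conj_circleDiagonal_mem`, definite places §2 `…_of_compactSpace` — and the docking to the
(T-ATLAS) charts `gprimeTorus S′ c`.  HONEST LABEL: HC_CM is proved only modulo the 7 printed citations (2 remaining: hLiu418 = `stmt-HodgeConjecture-24832`,
h413 = `stmt-HodgeConjecture-24833`) until rung 0 closes; this file pays no organ of the closer and moves no row of the books.

## References
* [DeitmarEchterhoff2014] A. Deitmar, S. Echterhoff, *Principles of Harmonic Analysis*, 2nd ed. (2014), Lemma 9.3.3 (orbital integrals of `C_c` functions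
  converge and vary continuously on the regular set), Thm. 1.5.3 (quotient integral formula).
* [Rogawski1990] J. D. Rogawski, *Automorphic Representations of Unitary Groups in Three Variables*, Ann. of Math. Stud. 123 (1990), §8.3 p. 122 (orbital
  integrals as functions on `T_reg`), §4.3 p. 43 (`G_∞ = Π_w G_w`).
* [Shelstad1979] D. Shelstad, *Characters and inner forms of a quasi-split group over ℝ*, Compositio Math. 39 (1979), §4 (the spaces of orbital integrals on
  `T_reg`, any `dt`).
* [Folland1995] G. B. Folland, *A Course in Abstract Harmonic Analysis* (1995), §2.6 Thm. 2.49 (`(Π G_i) ⧸ (Π H_i)`; invariant measures on quotients).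
* [Gelbart1975] S. Gelbart, *Automorphic forms on adele groups*, Ann. of Math. Stud. 83 (1975), p. 155 (10.19) (orbital integrals factor over places).
-/

set_option autoImplicit false

noncomputable section

open MeasureTheory MeasureTheory.Measure Set Topology Filter

namespace Literature.MeasureTheory.Group

/-! ## §0 Algebra: commutation with `M` along isomorphisms and in products -/

section Algebra

variable {G G' : Type*} [Group G] [Group G'] {X : Type*}

/-- Commutation transports along a group isomorphism: if `c(x)` commutes with `M` and `e(M) = M′` then `e(c x)` commutes with `M′`. [cite: Folland1995, §2.6 Thm. 2.49] -/
theorem forall_mem_mul_comm_map_of_forall_mem_iff (e : G ≃* G') (M : Subgroup G) (M' : Subgroup G') (hMM' : ∀ g, e g ∈ M' ↔ g ∈ M)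
    {c : X → G} (hcomm : ∀ x, ∀ m ∈ M, m * c x = c x * m) (x : X) :
    ∀ m' ∈ M', m' * e (c x) = e (c x) * m' := by
  intro m' hm'
  have hm : e.symm m' ∈ M := (forall_symm_mem_iff e M M' hMM' m').2 hm'
  have h := congrArg e (hcomm x (e.symm m') hm)
  rwa [map_mul, map_mul, MulEquiv.apply_symm_apply] at h

end Algebra

section AlgebraPi

variable {ι : Type*} {G : ι → Type*} [∀ i, Group (G i)] {X : ι → Type*}

/-- Componentwise commutation: if each `c_i(x_i)` commutes with `M_i` then `(c_i(x_i))_i` commutes with `Π_i M_i`. [cite: Folland1995, §2.6 Thm. 2.49] -/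
theorem forall_mem_pi_mul_comm (M : ∀ i, Subgroup (G i)) (c : ∀ i, X i → G i)
    (hcomm : ∀ i, ∀ x, ∀ m ∈ M i, m * c i x = c i x * m) (x : ∀ i, X i) :
    ∀ m ∈ Subgroup.pi Set.univ M, m * (fun i => c i (x i)) = (fun i => c i (x i)) * m := by
  intro m hm
  funext i
  exact hcomm i (x i) (m i) ((Subgroup.mem_pi _).1 hm i (Set.mem_univ i))

end AlgebraPi

/-! ## §1 Uniform properness modulo `M` ⇒ the quotient orbital integral is continuous -/

section UnifProper

variable {G : Type*} [Group G] [TopologicalSpace G] [IsTopologicalGroup G]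
  {X : Type*} [TopologicalSpace X]
  {E : Type*} [NormedAddCommGroup E] [NormedSpace ℝ E]

/-- **The orbital integrand is jointly continuous**: for a continuous chart `c : X → G` of elements commuting with `M` and a continuous `a` on `G`,
`(x, y M) ↦ a(y · c(x) · y⁻¹)` is continuous on `X × (G ⧸ M)` (lift through the open quotient map `id × mk`).
[cite: DeitmarEchterhoff2014, Lemma 9.3.3] -/
theorem continuous_descConj_prod (M : Subgroup G) {c : X → G} (hc : Continuous c) (hcomm : ∀ x, ∀ m ∈ M, m * c x = c x * m)
    {Y : Type*} [TopologicalSpace Y] {a : G → Y} (ha : Continuous a) :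
    Continuous fun p : X × (G ⧸ M) => descConj (c p.1) M (hcomm p.1) a p.2 := by
  have hq : IsOpenQuotientMap (Prod.map (id : X → X) (QuotientGroup.mk : G → G ⧸ M)) :=
    IsOpenQuotientMap.id.prodMap QuotientGroup.isOpenQuotientMap_mk
  rw [← hq.continuous_comp_iff]
  have h2 : (fun p : X × (G ⧸ M) => descConj (c p.1) M (hcomm p.1) a p.2) ∘ Prod.map (id : X → X) (QuotientGroup.mk : G → G ⧸ M) =
      fun p : X × G => a (p.2 * c p.1 * p.2⁻¹) := by
    funext p
    rfl
  rw [h2]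
  exact ha.comp ((continuous_snd.mul (hc.comp continuous_fst)).mul continuous_snd.inv)

/-- **UNIFORM PROPERNESS MODULO `M` ⇒ CONTINUITY OF THE QUOTIENT ORBITAL INTEGRAL ON THE REGULAR SET.**  Let `c : X → G` be a continuous chart of
elements commuting with the subgroup `M` (`X` locally compact), `S ⊆ X` open, and assume (HYP): for every compact `K ⊆ S` and compact `C ⊆ G` there is a
compact `𝒦 ⊆ G ⧸ M` containing `y M` whenever `y · c(x) · y⁻¹ ∈ C` for some `x ∈ K`.  Then for every `a ∈ C_c(G, E)` and EVERY measure `μ` on `G ⧸ M` finite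
on compact sets, `x ↦ ∫_{G ⧸ M} a(y · c(x) · y⁻¹) dμ(ȳ)` is continuous on `S`.  (Near `x₀ ∈ S` take a compact neighbourhood `K ⊆ S`; with `C = tsupport a` the
integrands for `x ∈ K` are supported in one compact `𝒦` and are jointly continuous — Mathlib `continuousOn_integral_of_compact_support`.)  The generic
form of ★ `continuousOn_integral_descConj_of_diag_hyperbolic` (split Cartan of `U(2,1)`) and ★ `continuousOn_integral_descConj_archDiagTorus_of_hasCompactSupport`
(compact Cartan). [cite: DeitmarEchterhoff2014, Lemma 9.3.3] [cite: Rogawski1990, §8.3 p. 122] [cite: Shelstad1979, §4] -/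
theorem continuousOn_integral_descConj_of_uniformlyProper [LocallyCompactSpace X]
    (M : Subgroup G) {c : X → G} (hc : Continuous c) (hcomm : ∀ x, ∀ m ∈ M, m * c x = c x * m)
    {S : Set X} (hS : IsOpen S)
    (hprop : ∀ K ⊆ S, IsCompact K → ∀ C : Set G, IsCompact C →
      ∃ 𝒦 : Set (G ⧸ M), IsCompact 𝒦 ∧ ∀ x ∈ K, ∀ y : G, y * c x * y⁻¹ ∈ C → (QuotientGroup.mk y : G ⧸ M) ∈ 𝒦)
    [MeasurableSpace (G ⧸ M)] [OpensMeasurableSpace (G ⧸ M)]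
    (μ : Measure (G ⧸ M)) [IsFiniteMeasureOnCompacts μ]
    {a : G → E} (ha : Continuous a) (hac : HasCompactSupport a) :
    ContinuousOn (fun x => ∫ q, descConj (c x) M (hcomm x) a q ∂μ) S := by
  intro x₀ hx₀
  obtain ⟨K, hKnhds, hKsub, hK⟩ := local_compact_nhds (hS.mem_nhds hx₀)
  obtain ⟨𝒦, h𝒦, hmem⟩ := hprop K hKsub hK (tsupport a) hac.isCompact
  have hF := continuous_descConj_prod M hc hcomm ha
  have hcont : ContinuousOn (fun x => ∫ q, descConj (c x) M (hcomm x) a q ∂μ) K := by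
    refine continuousOn_integral_of_compact_support h𝒦 hF.continuousOn ?_
    intro x q hx hq
    induction q using QuotientGroup.induction_on with
    | H y =>
      rw [descConj_mk]
      by_contra hne
      exact hq (hmem x hx y (subset_tsupport _ (Function.mem_support.2 hne)))
  exact ((continuousWithinAt_iff_continuousAt hKnhds).mp (hcont x₀ (mem_of_mem_nhds hKnhds))).continuousWithinAt

/-- **The everywhere-proper case**: if (HYP) holds on all of `X` (e.g. `c` ranges over regular elements only), the quotient orbital integral is continuous
on `X`. [cite: DeitmarEchterhoff2014, Lemma 9.3.3] -/
theorem continuous_integral_descConj_of_uniformlyProper [LocallyCompactSpace X]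
    (M : Subgroup G) {c : X → G} (hc : Continuous c) (hcomm : ∀ x, ∀ m ∈ M, m * c x = c x * m)
    (hprop : ∀ K : Set X, IsCompact K → ∀ C : Set G, IsCompact C →
      ∃ 𝒦 : Set (G ⧸ M), IsCompact 𝒦 ∧ ∀ x ∈ K, ∀ y : G, y * c x * y⁻¹ ∈ C → (QuotientGroup.mk y : G ⧸ M) ∈ 𝒦)
    [MeasurableSpace (G ⧸ M)] [OpensMeasurableSpace (G ⧸ M)]
    (μ : Measure (G ⧸ M)) [IsFiniteMeasureOnCompacts μ]
    {a : G → E} (ha : Continuous a) (hac : HasCompactSupport a) :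
    Continuous fun x => ∫ q, descConj (c x) M (hcomm x) a q ∂μ := by
  rw [← continuousOn_univ]
  exact continuousOn_integral_descConj_of_uniformlyProper M hc hcomm isOpen_univ (fun K _ hK C hC => hprop K hK C hC) μ ha hac

end UnifProper

/-! ## §2 Stability of uniform properness: group-level properness, compact factors, transport, finite products -/

section Feeders

variable {G : Type*} [Group G] [TopologicalSpace G] {X : Type*} [TopologicalSpace X]

/-- **GROUP-LEVEL PROPERNESS ⇒ (HYP).**  If for all compact `K ⊆ S`, `C ⊆ G` the set `{y ∣ ∃ x ∈ K, y · c(x) · y⁻¹ ∈ C}` lies in a compact subset of `G`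
ITSELF (the case of a COMPACT Cartan `M` at a regular family: ★ `isCompact_setOf_exists_conj_circleDiagonal_mem`), then the data is uniformly proper modulo
`M` (image of that compact set in `G ⧸ M`). [cite: Rogawski1990, §8.3 p. 122] [cite: DeitmarEchterhoff2014, Lemma 9.3.3] -/
theorem uniformlyProper_of_forall_exists_isCompact (M : Subgroup G) (c : X → G) (S : Set X)
    (h : ∀ K ⊆ S, IsCompact K → ∀ C : Set G, IsCompact C →
      ∃ B : Set G, IsCompact B ∧ ∀ x ∈ K, ∀ y : G, y * c x * y⁻¹ ∈ C → y ∈ B) :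
    ∀ K ⊆ S, IsCompact K → ∀ C : Set G, IsCompact C →
      ∃ 𝒦 : Set (G ⧸ M), IsCompact 𝒦 ∧ ∀ x ∈ K, ∀ y : G, y * c x * y⁻¹ ∈ C → (QuotientGroup.mk y : G ⧸ M) ∈ 𝒦 := by
  intro K hKS hK C hC
  obtain ⟨B, hB, hmem⟩ := h K hKS hK C hC
  exact ⟨QuotientGroup.mk '' B, hB.image continuous_quotient_mk', fun x hx y hy => ⟨y, hmem x hx y hy, rfl⟩⟩

/-- **A COMPACT FACTOR IS UNIFORMLY PROPER FOR FREE** (a definite place: `G′_w = U(3)` compact): `𝒦 := univ`. [cite: Rogawski1990, §4.3 p. 43] -/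
theorem uniformlyProper_of_compactSpace [CompactSpace G] (M : Subgroup G) (c : X → G) (S : Set X) :
    ∀ K ⊆ S, IsCompact K → ∀ C : Set G, IsCompact C →
      ∃ 𝒦 : Set (G ⧸ M), IsCompact 𝒦 ∧ ∀ x ∈ K, ∀ y : G, y * c x * y⁻¹ ∈ C → (QuotientGroup.mk y : G ⧸ M) ∈ 𝒦 :=
  fun _ _ _ _ _ => ⟨Set.univ, isCompact_univ, fun _ _ _ _ => Set.mem_univ _⟩

/-- **(HYP) restricts to smaller sets.** [cite: DeitmarEchterhoff2014, Lemma 9.3.3] -/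
theorem uniformlyProper_mono (M : Subgroup G) (c : X → G) {S S' : Set X} (hS' : S' ⊆ S)
    (h : ∀ K ⊆ S, IsCompact K → ∀ C : Set G, IsCompact C →
      ∃ 𝒦 : Set (G ⧸ M), IsCompact 𝒦 ∧ ∀ x ∈ K, ∀ y : G, y * c x * y⁻¹ ∈ C → (QuotientGroup.mk y : G ⧸ M) ∈ 𝒦) :
    ∀ K ⊆ S', IsCompact K → ∀ C : Set G, IsCompact C →
      ∃ 𝒦 : Set (G ⧸ M), IsCompact 𝒦 ∧ ∀ x ∈ K, ∀ y : G, y * c x * y⁻¹ ∈ C → (QuotientGroup.mk y : G ⧸ M) ∈ 𝒦 :=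
  fun K hK => h K (hK.trans hS')

/-- **(HYP) pulls back along a continuous re-parametrisation** `d : Z → X` with `d(S₀) ⊆ S` (e.g. the coordinate chart of a Cartan family composed with a
projection). [cite: DeitmarEchterhoff2014, Lemma 9.3.3] -/
theorem uniformlyProper_comp (M : Subgroup G) (c : X → G) {S : Set X}
    (h : ∀ K ⊆ S, IsCompact K → ∀ C : Set G, IsCompact C →
      ∃ 𝒦 : Set (G ⧸ M), IsCompact 𝒦 ∧ ∀ x ∈ K, ∀ y : G, y * c x * y⁻¹ ∈ C → (QuotientGroup.mk y : G ⧸ M) ∈ 𝒦)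
    {Z : Type*} [TopologicalSpace Z] {d : Z → X} (hd : Continuous d) {S₀ : Set Z} (hS₀ : Set.MapsTo d S₀ S) :
    ∀ K ⊆ S₀, IsCompact K → ∀ C : Set G, IsCompact C →
      ∃ 𝒦 : Set (G ⧸ M), IsCompact 𝒦 ∧ ∀ z ∈ K, ∀ y : G, y * (c ∘ d) z * y⁻¹ ∈ C → (QuotientGroup.mk y : G ⧸ M) ∈ 𝒦 := by
  intro K hKS hK C hC
  obtain ⟨𝒦, h𝒦, hmem⟩ := h (d '' K) (fun _ ⟨z, hz, hzx⟩ => hzx ▸ hS₀ (hKS hz)) (hK.image hd) C hC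
  exact ⟨𝒦, h𝒦, fun z hz y hy => hmem (d z) ⟨z, hz, rfl⟩ y hy⟩

/-- **TRANSPORT OF (HYP) ALONG A BICONTINUOUS ISOMORPHISM** `e : G ≃* G′` with `e(M) = M′` (the ★ `cosetCongr` compatibility): the chart `e ∘ c` is
uniformly proper modulo `M′` (`𝒦′ := cosetCongr e (𝒦)`, `C := e⁻¹(C′)`).  Used with `e = archPiEquivCM⁻¹ : Π_w G′_w ≃ G′_∞`.
[cite: Folland1995, §2.6 Thm. 2.49] [cite: Gelbart1975, p. 155 (10.19)] -/
theorem uniformlyProper_map_mulEquiv {G' : Type*} [Group G'] [TopologicalSpace G']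
    (e : G ≃* G') (he : Continuous e) (hes : Continuous e.symm)
    (M : Subgroup G) (M' : Subgroup G') (hMM' : ∀ g, e g ∈ M' ↔ g ∈ M) (c : X → G) {S : Set X}
    (h : ∀ K ⊆ S, IsCompact K → ∀ C : Set G, IsCompact C →
      ∃ 𝒦 : Set (G ⧸ M), IsCompact 𝒦 ∧ ∀ x ∈ K, ∀ y : G, y * c x * y⁻¹ ∈ C → (QuotientGroup.mk y : G ⧸ M) ∈ 𝒦) :
    ∀ K ⊆ S, IsCompact K → ∀ C' : Set G', IsCompact C' →
      ∃ 𝒦' : Set (G' ⧸ M'), IsCompact 𝒦' ∧ ∀ x ∈ K, ∀ y' : G', y' * e (c x) * y'⁻¹ ∈ C' → (QuotientGroup.mk y' : G' ⧸ M') ∈ 𝒦' := by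
  intro K hKS hK C' hC'
  obtain ⟨𝒦, h𝒦, hmem⟩ := h K hKS hK (e.symm '' C') (hC'.image hes)
  refine ⟨cosetCongr e M M' hMM' '' 𝒦, h𝒦.image (continuous_cosetCongr e M M' hMM' he), fun x hx y' hy' => ?_⟩
  have hy : e.symm y' * c x * (e.symm y')⁻¹ ∈ e.symm '' C' := by
    refine ⟨y' * e (c x) * y'⁻¹, hy', ?_⟩
    rw [map_mul, map_mul, map_inv, MulEquiv.symm_apply_apply]
  refine ⟨QuotientGroup.mk (e.symm y'), hmem x hx (e.symm y') hy, ?_⟩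
  rw [cosetCongr_mk, MulEquiv.apply_symm_apply]

end Feeders

section Pi

variable {ι : Type*} {G : ι → Type*} [∀ i, Group (G i)] [∀ i, TopologicalSpace (G i)] {X : ι → Type*} [∀ i, TopologicalSpace (X i)]

/-- **«PLACES MULTIPLY» FOR UNIFORM PROPERNESS.**  If every factor `(G_i, M_i, c_i)` is uniformly proper modulo `M_i` on `S_i` (finite index set),
then the product `(Π G_i, Π M_i, (c_i)_i)` is uniformly proper modulo `Π M_i` on `Set.pi univ S`: with `K_i`, `C_i` the (compact) coordinate projections
of `K`, `C` and `𝒦_i` the factor sets, `𝒦 := quotientPiHomeomorph⁻¹ (Π_i 𝒦_i)` works, since `y · c(x) · y⁻¹ ∈ C` forces `y_i · c_i(x_i) · y_i⁻¹ ∈ C_i` for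
every `i`. [cite: Folland1995, §2.6 Thm. 2.49] [cite: Gelbart1975, p. 155 (10.19)] [cite: Rogawski1990, §4.3 p. 43] -/
theorem uniformlyProper_pi [∀ i, IsTopologicalGroup (G i)] (M : ∀ i, Subgroup (G i)) (c : ∀ i, X i → G i) (S : ∀ i, Set (X i))
    (hprop : ∀ i, ∀ K ⊆ S i, IsCompact K → ∀ C : Set (G i), IsCompact C →
      ∃ 𝒦 : Set (G i ⧸ M i), IsCompact 𝒦 ∧ ∀ x ∈ K, ∀ y : G i, y * c i x * y⁻¹ ∈ C → (QuotientGroup.mk y : G i ⧸ M i) ∈ 𝒦) :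
    ∀ K ⊆ Set.pi Set.univ S, IsCompact K → ∀ C : Set (∀ i, G i), IsCompact C →
      ∃ 𝒦 : Set ((∀ i, G i) ⧸ Subgroup.pi Set.univ M), IsCompact 𝒦 ∧
        ∀ x ∈ K, ∀ y : ∀ i, G i, y * (fun i => c i (x i)) * y⁻¹ ∈ C →
          (QuotientGroup.mk y : (∀ i, G i) ⧸ Subgroup.pi Set.univ M) ∈ 𝒦 := by
  intro K hKS hK C hC
  have hKi : ∀ i, IsCompact ((fun x : ∀ j, X j => x i) '' K) := fun i => hK.image (continuous_apply i)
  have hKiS : ∀ i, (fun x : ∀ j, X j => x i) '' K ⊆ S i := by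
    rintro i _ ⟨x, hx, rfl⟩
    exact hKS hx i (Set.mem_univ i)
  have hCi : ∀ i, IsCompact ((fun y : ∀ j, G j => y i) '' C) := fun i => hC.image (continuous_apply i)
  choose 𝒦 h𝒦 hmem using fun i => hprop i _ (hKiS i) (hKi i) _ (hCi i)
  refine ⟨quotientPiHomeomorph M ⁻¹' Set.pi Set.univ 𝒦, (quotientPiHomeomorph M).isCompact_preimage.2 (isCompact_univ_pi h𝒦), ?_⟩
  intro x hx y hy
  rw [Set.mem_preimage, coe_quotientPiHomeomorph, quotientPiEquiv_mk]
  intro i _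
  exact hmem i (x i) ⟨x, hx, rfl⟩ (y i) ⟨y * (fun i => c i (x i)) * y⁻¹, hy, rfl⟩

variable {E : Type*} [NormedAddCommGroup E] [NormedSpace ℝ E]

/-! ## §3 The places assembly: continuity on the product of the regular sets -/

/-- **CONTINUITY OF THE PRODUCT-QUOTIENT ORBITAL INTEGRAL ON THE PRODUCT OF THE REGULAR SETS.**  For finitely many factors `(G_i, M_i, c_i)`, each uniformly
proper modulo `M_i` on an open `S_i` (`X_i` locally compact), every `a ∈ C_c(Π G_i, E)` and every measure `μ` on `(Π G_i) ⧸ (Π M_i)` finite on compact sets,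
`x ↦ ∫ a(y · (c_i(x_i))_i · y⁻¹) dμ(ȳ)` is continuous on `Set.pi univ S` (§1 over `uniformlyProper_pi`).  With `G_i = G′_w`, `M_i = T_w` the Cartan factor at the
complex place `w` and `S_i` its regular set this is clause (M1) «ordinary orbital integrals are continuous on `T_{S′}^{reg}`» in product coordinates.
[cite: Rogawski1990, §8.3 p. 122; §4.3 p. 43] [cite: DeitmarEchterhoff2014, Lemma 9.3.3] [cite: Folland1995, §2.6 Thm. 2.49] -/
theorem continuousOn_integral_descConj_pi_of_uniformlyProper [Finite ι] [∀ i, IsTopologicalGroup (G i)] [∀ i, LocallyCompactSpace (X i)]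
    (M : ∀ i, Subgroup (G i)) {c : ∀ i, X i → G i} (hc : ∀ i, Continuous (c i))
    (hcomm : ∀ i, ∀ x, ∀ m ∈ M i, m * c i x = c i x * m)
    {S : ∀ i, Set (X i)} (hS : ∀ i, IsOpen (S i))
    (hprop : ∀ i, ∀ K ⊆ S i, IsCompact K → ∀ C : Set (G i), IsCompact C →
      ∃ 𝒦 : Set (G i ⧸ M i), IsCompact 𝒦 ∧ ∀ x ∈ K, ∀ y : G i, y * c i x * y⁻¹ ∈ C → (QuotientGroup.mk y : G i ⧸ M i) ∈ 𝒦)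
    [MeasurableSpace ((∀ i, G i) ⧸ Subgroup.pi Set.univ M)] [OpensMeasurableSpace ((∀ i, G i) ⧸ Subgroup.pi Set.univ M)]
    (μ : Measure ((∀ i, G i) ⧸ Subgroup.pi Set.univ M)) [IsFiniteMeasureOnCompacts μ]
    {a : (∀ i, G i) → E} (ha : Continuous a) (hac : HasCompactSupport a) :
    ContinuousOn (fun x : ∀ i, X i =>
      ∫ q, descConj (fun i => c i (x i)) (Subgroup.pi Set.univ M) (forall_mem_pi_mul_comm M c hcomm x) a q ∂μ) (Set.pi Set.univ S) :=
  continuousOn_integral_descConj_of_uniformlyProper (Subgroup.pi Set.univ M)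
    (continuous_pi fun i => (hc i).comp (continuous_apply i)) (forall_mem_pi_mul_comm M c hcomm)
    (isOpen_set_pi Set.finite_univ fun i _ => hS i) (uniformlyProper_pi M c S hprop) μ ha hac

/-- **THE SAME ON ANY GROUP `G′ ≅ Π_i G_i`** (bicontinuous `e`, `e(Π M_i) = M′` — the ★ `cosetCongr` compatibility, e.g. `e = archPiEquivCM⁻¹`,
`M′ = T_{S′} ≤ G′_∞ = U(H′)(L⁺ ⊗ ℝ)`, `M_w = T_w`): for `a′ ∈ C_c(G′, E)` and ANY measure `μ′` on `G′ ⧸ M′` finite on compact sets,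
`x ↦ ∫_{G′ ⧸ M′} a′(y′ · e((c_i(x_i))_i) · y′⁻¹) dμ′` is continuous on `Set.pi univ S` (§1 over `uniformlyProper_map_mulEquiv ∘ uniformlyProper_pi`).
[cite: Rogawski1990, §8.3 p. 122; §4.3 p. 43] [cite: Gelbart1975, p. 155 (10.19)] [cite: Folland1995, §2.6 Thm. 2.49] [cite: DeitmarEchterhoff2014, Lemma 9.3.3] -/
theorem continuousOn_integral_descConj_mulEquiv_pi_of_uniformlyProper [Finite ι] [∀ i, IsTopologicalGroup (G i)] [∀ i, LocallyCompactSpace (X i)]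
    {G' : Type*} [Group G'] [TopologicalSpace G'] [IsTopologicalGroup G']
    (e : (∀ i, G i) ≃* G') (he : Continuous e) (hes : Continuous e.symm)
    (M : ∀ i, Subgroup (G i)) (M' : Subgroup G') (hMM' : ∀ g, e g ∈ M' ↔ g ∈ Subgroup.pi Set.univ M)
    {c : ∀ i, X i → G i} (hc : ∀ i, Continuous (c i)) (hcomm : ∀ i, ∀ x, ∀ m ∈ M i, m * c i x = c i x * m)
    {S : ∀ i, Set (X i)} (hS : ∀ i, IsOpen (S i))
    (hprop : ∀ i, ∀ K ⊆ S i, IsCompact K → ∀ C : Set (G i), IsCompact C →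
      ∃ 𝒦 : Set (G i ⧸ M i), IsCompact 𝒦 ∧ ∀ x ∈ K, ∀ y : G i, y * c i x * y⁻¹ ∈ C → (QuotientGroup.mk y : G i ⧸ M i) ∈ 𝒦)
    [MeasurableSpace (G' ⧸ M')] [OpensMeasurableSpace (G' ⧸ M')]
    (μ' : Measure (G' ⧸ M')) [IsFiniteMeasureOnCompacts μ']
    {a' : G' → E} (ha' : Continuous a') (hac' : HasCompactSupport a') :
    ContinuousOn (fun x : ∀ i, X i =>
      ∫ q, descConj (e fun i => c i (x i)) M'
        (forall_mem_mul_comm_map_of_forall_mem_iff e (Subgroup.pi Set.univ M) M' hMM' (forall_mem_pi_mul_comm M c hcomm) x) a' q ∂μ')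
      (Set.pi Set.univ S) :=
  continuousOn_integral_descConj_of_uniformlyProper M'
    (he.comp (continuous_pi fun i => (hc i).comp (continuous_apply i)))
    (forall_mem_mul_comm_map_of_forall_mem_iff e (Subgroup.pi Set.univ M) M' hMM' (forall_mem_pi_mul_comm M c hcomm))
    (isOpen_set_pi Set.finite_univ fun i _ => hS i)
    (uniformlyProper_map_mulEquiv e he hes (Subgroup.pi Set.univ M) M' hMM' (fun x : ∀ i, X i => fun i => c i (x i))
      (uniformlyProper_pi M c S hprop))
    μ' ha' hac'

end Pi

end Literature.MeasureTheory.Group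

end
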